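import Summits.CriticalPhenomena.PercolationContinuityZ3.Theorems.PercNearOneGluingNoHeavyLowerTailHullPortTANDefs
import Summits.CriticalPhenomena.PercolationContinuityZ3.Theorems.PercNearOneGluingNoHeavyLowerTailQ7PsiSetObserver
import Literature.Probability.Percolation.LonePortSumGeneral
import HarnessLib

/-!
# `NoHeavyLowerTail` (stmt-CriticalPhenomena-4575) — the set-observer covariance comparison for EDGE-cluster functions

Support file (prover `prim-hp-7`; `--supports stmt-CriticalPhenomena-4575`); no definitions, named facts or sorries.
The coupling seat's `Q7Psi.setObs_cov_ge` (blueprint step B1 of A5-COUPLING-gen13.md §5, the `z`-free core of the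
set-observer marker dominance lemma = Kozma–Nitzan Question 9 at `|A| = 3`) is stated for monotone functions of the
open VERTEX cluster.  prim-lit-3's reduction theorem (`TwoClusterGibbsCovariance.lean`), through which the set-observer
marker dominance lemma is proved (blueprint B3–B4, prim-hp-7), quantifies over monotone functions of the open EDGE
cluster, so the per-cluster input is needed in that generality.  This file repeats the coupling seat's three steps
verbatim for `F (openEdgeCluster ω x)`, `F` monotone on `Set (Sym2 V)`:
* `HullPort.setObs_neg_edge` — BHK Thm 1.5 for `F(C_x)` and `−𝟙{x ↮ N} 𝟙{y ↔ N}` given `{x ↮ y}`;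
* `HullPort.harris_setObs_union_edge` — Harris for `F(C_x)` and `{x ↔ N} ∪ {y ↔ N}`;
* `HullPort.setObs_cov_ge_edge` — `μ(x↮y, x↮N, y↔N)·(∫_{x↔y} F − μ(x↔y)∫F) ≤ μ(x↮y)·(∫_{x↔N} F − μ(x↔N)∫F)`;
* `HullPort.setObs_cov_ge_edge_sum` — the same as an inequality of finite weighted sums in the vocabulary of
  `…HullPortTANDefs` (`connS`, `sepEv`), the form used configuration-by-configuration in `G − cut_X(ω)`.
[cite: VandenbergHaggstromKahn2005, Thms 1.4–1.5 (p. 7); §1 p. 6 (Harris)] [cite: KozmaNitzan2024, Question 9 (p. 36)]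
-/

namespace Summit.CriticalPhenomena.PercolationContinuityZ3.Theorems

open MeasureTheory Set Literature.Probability.LatticeModels Literature.Probability.Percolation
open scoped Classical
open KNPreFKG

noncomputable section

namespace HullPort

open BHK2006 DecisionTree LonePortSum LonePortSumGeneral

variable {V : Type*} [Fintype V]

/-- **BHK Thm 1.5 for a monotone edge-cluster function and a set of observers**: with `D = {x ↮ y}`,
`μ(D) · ∫_{D ∩ {x ↮ N} ∩ {y ↔ N}} F(C_x) ≤ (∫_D F(C_x)) · μ(D ∩ {x ↮ N} ∩ {y ↔ N})`.
(The coupling seat's `Q7Psi.setObs_neg`, edge-cluster form.) [cite: VandenbergHaggstromKahn2005, Thm. 1.5 (p. 7)] -/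
theorem setObs_neg_edge (w : Sym2 V → unitInterval) (x y : V) (N : Set V) (hxy : x ≠ y) (F : Set (Sym2 V) → ℝ)
    (hF : Monotone F) :
    (prodBernoulli w).real {ω : BondConfig V | ¬ (openGraph ω).Reachable x y} *
        ∫ ω in {ω : BondConfig V | ¬ (openGraph ω).Reachable x y} ∩
            ({ω | ∀ n ∈ N, ¬ (openGraph ω).Reachable x n} ∩ {ω | ∃ n ∈ N, (openGraph ω).Reachable y n}),
          F (openEdgeCluster ω x) ∂(prodBernoulli w) ≤
      (∫ ω in {ω : BondConfig V | ¬ (openGraph ω).Reachable x y}, F (openEdgeCluster ω x) ∂(prodBernoulli w)) *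
        (prodBernoulli w).real ({ω : BondConfig V | ¬ (openGraph ω).Reachable x y} ∩
          ({ω | ∀ n ∈ N, ¬ (openGraph ω).Reachable x n} ∩ {ω | ∃ n ∈ N, (openGraph ω).Reachable y n})) := by
  classical
  set E : Set (BondConfig V) :=
    {ω | ∀ n ∈ N, ¬ (openGraph ω).Reachable x n} ∩ {ω | ∃ n ∈ N, (openGraph ω).Reachable y n} with hE
  set G : Set (Sym2 V) → Set (Sym2 V) → ℝ := fun C C' =>
    -(if (∀ n ∈ N, ¬ (n = x ∨ ∃ e ∈ C, n ∈ e)) ∧ (∃ n ∈ N, n = y ∨ ∃ e ∈ C', n ∈ e) then (1 : ℝ) else 0)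
    with hG
  have hGmono : ∀ C', Monotone fun C => G C C' := by
    intro C' C₁ C₂ h12
    simp only [hG]
    refine neg_le_neg ?_
    by_cases h2 : (∀ n ∈ N, ¬ (n = x ∨ ∃ e ∈ C₂, n ∈ e)) ∧ (∃ n ∈ N, n = y ∨ ∃ e ∈ C', n ∈ e)
    · have h1 : (∀ n ∈ N, ¬ (n = x ∨ ∃ e ∈ C₁, n ∈ e)) ∧ (∃ n ∈ N, n = y ∨ ∃ e ∈ C', n ∈ e) :=
        ⟨fun n hn hc => h2.1 n hn (hc.imp id fun ⟨e, he, hne⟩ => ⟨e, h12 he, hne⟩), h2.2⟩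
      rw [if_pos h2, if_pos h1]
    · rw [if_neg h2]
      split_ifs
      · exact zero_le_one
      · exact le_rfl
  have hGanti : ∀ C, Antitone fun C' => G C C' := by
    intro C C₁ C₂ h12
    simp only [hG]
    refine neg_le_neg ?_
    by_cases h1 : (∀ n ∈ N, ¬ (n = x ∨ ∃ e ∈ C, n ∈ e)) ∧ (∃ n ∈ N, n = y ∨ ∃ e ∈ C₁, n ∈ e)
    · have h2 : (∀ n ∈ N, ¬ (n = x ∨ ∃ e ∈ C, n ∈ e)) ∧ (∃ n ∈ N, n = y ∨ ∃ e ∈ C₂, n ∈ e) :=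
        ⟨h1.1, h1.2.imp fun n ⟨hn, hc⟩ => ⟨hn, hc.imp id fun ⟨e, he, hne⟩ => ⟨e, h12 he, hne⟩⟩⟩
      rw [if_pos h1, if_pos h2]
    · rw [if_neg h1]
      split_ifs
      · exact zero_le_one
      · exact le_rfl
  have hGval : ∀ ω : BondConfig V,
      G (openEdgeCluster ω x) (openEdgeCluster ω y) = -(E.indicator (1 : BondConfig V → ℝ) ω) := by
    intro ω
    simp only [hG]
    congr 1
    by_cases hω : ω ∈ E
    · rw [indicator_of_mem hω, Pi.one_apply, if_pos]
      refine ⟨fun n hn hc => hω.1 n hn ((reachable_iff_exists_mem_openEdgeCluster ω x n).2 hc), ?_⟩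
      obtain ⟨n, hn, hr⟩ := hω.2
      exact ⟨n, hn, (reachable_iff_exists_mem_openEdgeCluster ω y n).1 hr⟩
    · rw [indicator_of_notMem hω, if_neg]
      rintro ⟨h1, n, hn, hc⟩
      exact hω ⟨fun n' hn' hr => h1 n' hn' ((reachable_iff_exists_mem_openEdgeCluster ω x n').1 hr),
        n, hn, (reachable_iff_exists_mem_openEdgeCluster ω y n).2 hc⟩
  have key := BHK2006_twoClusterConditionalAssociation_holds V w x y
    (fun C _ => F C) G (fun _ => hF) (fun _ => antitone_const) hGmono hGanti hxy
  simp only [hGval, mul_neg, integral_neg] at key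
  rw [setIntegral_mul_indicator_one, setIntegral_indicator_one_eq] at key
  linarith

/-- **Harris for a monotone edge-cluster function and the union event of a set of observers**: with
`J = {x ↔ N} ∪ {y ↔ N}`, `μ(J) · ∫ F(C_x) ≤ ∫_J F(C_x)`. (The coupling seat's `Q7Psi.harris_setObs_union`, edge form.)
[cite: VandenbergHaggstromKahn2005, §1 p. 6 (Harris' inequality)] -/
theorem harris_setObs_union_edge (w : Sym2 V → unitInterval) (x y : V) (N : Set V) (F : Set (Sym2 V) → ℝ)
    (hF : Monotone F) :
    (prodBernoulli w).real ({ω : BondConfig V | ∃ n ∈ N, (openGraph ω).Reachable x n} ∪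
          {ω | ∃ n ∈ N, (openGraph ω).Reachable y n}) * ∫ ω, F (openEdgeCluster ω x) ∂(prodBernoulli w) ≤
      ∫ ω in {ω : BondConfig V | ∃ n ∈ N, (openGraph ω).Reachable x n} ∪
          {ω | ∃ n ∈ N, (openGraph ω).Reachable y n}, F (openEdgeCluster ω x) ∂(prodBernoulli w) := by
  classical
  set μ := prodBernoulli w with hμ
  set J : Set (BondConfig V) := {ω : BondConfig V | ∃ n ∈ N, (openGraph ω).Reachable x n} ∪
    {ω | ∃ n ∈ N, (openGraph ω).Reachable y n} with hJ
  have hJm : MeasurableSet J := MeasurableSet.of_discrete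
  have hfm : Monotone fun ω : BondConfig V => F (openEdgeCluster ω x) :=
    fun ω ω' h => hF (openEdgeCluster_mono h x)
  have hJup : IsUpperSet J := by
    intro ω ω' hle hω
    rcases hω with ⟨n, hn, h⟩ | ⟨n, hn, h⟩
    · exact Or.inl ⟨n, hn, h.mono (SimpleGraph.fromEdgeSet_mono hle)⟩
    · exact Or.inr ⟨n, hn, h.mono (SimpleGraph.fromEdgeSet_mono hle)⟩
  have hgm : Monotone (J.indicator (1 : BondConfig V → ℝ)) := monotone_indicator_one_of_isUpperSet hJup
  have key := BHK2006.integral_mul_le_prodBernoulli w hfm hgm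
  have h1 : ∫ ω, J.indicator (1 : BondConfig V → ℝ) ω ∂μ = μ.real J := by
    rw [integral_indicator_one hJm]
  have h2 : ∫ ω, F (openEdgeCluster ω x) * J.indicator (1 : BondConfig V → ℝ) ω ∂μ =
      ∫ ω in J, F (openEdgeCluster ω x) ∂μ := by
    have hfun : (fun ω => F (openEdgeCluster ω x) * J.indicator (1 : BondConfig V → ℝ) ω) =
        J.indicator (fun ω => F (openEdgeCluster ω x)) := by
      funext ω
      by_cases h : ω ∈ J
      · rw [indicator_of_mem h, indicator_of_mem h, Pi.one_apply, mul_one]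
      · rw [indicator_of_notMem h, indicator_of_notMem h, mul_zero]
    rw [hfun, integral_indicator hJm]
  rw [h1, h2] at key
  linarith [key]

/-- **The set-observer covariance comparison, edge-cluster form**: with `D = {x ↮ y}`,
`μ(D ∩ {x ↮ N} ∩ {y ↔ N}) · (∫_{x↔y} F(C_x) − μ(x↔y) ∫ F(C_x)) ≤ μ(D) · (∫_{x↔N} F(C_x) − μ(x↔N) ∫ F(C_x))` for every
monotone `F` of the open edge cluster of `x` (the coupling seat's `Q7Psi.setObs_cov_ge`, edge form; same proof).
[cite: VandenbergHaggstromKahn2005, Thms 1.4–1.5 (p. 7)] [cite: KozmaNitzan2024, Lemma 2 (p. 6), Question 9 (p. 36)] -/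
theorem setObs_cov_ge_edge (w : Sym2 V → unitInterval) (x y : V) (N : Set V) (hxy : x ≠ y) (F : Set (Sym2 V) → ℝ)
    (hF : Monotone F) :
    (prodBernoulli w).real ({ω : BondConfig V | ¬ (openGraph ω).Reachable x y} ∩
          ({ω | ∀ n ∈ N, ¬ (openGraph ω).Reachable x n} ∩ {ω | ∃ n ∈ N, (openGraph ω).Reachable y n})) *
        (∫ ω in openConn x y, F (openEdgeCluster ω x) ∂(prodBernoulli w) -
          (prodBernoulli w).real (openConn x y) * ∫ ω, F (openEdgeCluster ω x) ∂(prodBernoulli w)) ≤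
      (prodBernoulli w).real {ω : BondConfig V | ¬ (openGraph ω).Reachable x y} *
        (∫ ω in {ω : BondConfig V | ∃ n ∈ N, (openGraph ω).Reachable x n}, F (openEdgeCluster ω x) ∂(prodBernoulli w) -
          (prodBernoulli w).real {ω : BondConfig V | ∃ n ∈ N, (openGraph ω).Reachable x n} *
            ∫ ω, F (openEdgeCluster ω x) ∂(prodBernoulli w)) := by
  classical
  set μ := prodBernoulli w with hμ
  set D : Set (BondConfig V) := {ω | ¬ (openGraph ω).Reachable x y} with hD
  set O : Set (BondConfig V) := {ω : BondConfig V | ∃ n ∈ N, (openGraph ω).Reachable x n} with hO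
  set Oy : Set (BondConfig V) := {ω : BondConfig V | ∃ n ∈ N, (openGraph ω).Reachable y n} with hOy
  set E : Set (BondConfig V) :=
    {ω | ∀ n ∈ N, ¬ (openGraph ω).Reachable x n} ∩ {ω | ∃ n ∈ N, (openGraph ω).Reachable y n} with hE
  set f : BondConfig V → ℝ := fun ω => F (openEdgeCluster ω x) with hf
  set J : Set (BondConfig V) := O ∪ Oy with hJ
  have h15 := setObs_neg_edge w x y N hxy F hF
  change μ.real D * ∫ ω in D ∩ E, f ω ∂μ ≤ (∫ ω in D, f ω ∂μ) * μ.real (D ∩ E) at h15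
  have hH := harris_setObs_union_edge w x y N F hF
  change μ.real J * ∫ ω, f ω ∂μ ≤ ∫ ω in J, f ω ∂μ at hH
  show μ.real (D ∩ E) * (∫ ω in openConn x y, f ω ∂μ - μ.real (openConn x y) * ∫ ω, f ω ∂μ) ≤
    μ.real D * (∫ ω in O, f ω ∂μ - μ.real O * ∫ ω, f ω ∂μ)
  have hJeq : J = O ∪ (D ∩ E) := by
    ext ω
    simp only [hJ, hO, hOy, hD, hE, mem_union, mem_inter_iff, mem_setOf_eq]
    constructor
    · rintro (h | ⟨n, hn, h⟩)
      · exact Or.inl h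
      · by_cases hxN : ∀ n' ∈ N, ¬ (openGraph ω).Reachable x n'
        · exact Or.inr ⟨fun hxy' => hxN n hn (hxy'.trans h), hxN, n, hn, h⟩
        · simp only [not_forall, not_not] at hxN
          obtain ⟨n', hn', h'⟩ := hxN
          exact Or.inl ⟨n', hn', h'⟩
    · rintro (h | ⟨_, _, h⟩)
      · exact Or.inl h
      · exact Or.inr h
  have hdisj : Disjoint O (D ∩ E) := by
    rw [Set.disjoint_left]
    rintro ω ⟨n, hn, hxn⟩ ⟨_, hxN, _⟩
    exact hxN n hn hxn
  have hJm : μ.real J = μ.real O + μ.real (D ∩ E) := by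
    rw [hJeq, measureReal_union hdisj MeasurableSet.of_discrete]
  have hsplit : ∫ ω in J, f ω ∂μ = ∫ ω in O, f ω ∂μ + ∫ ω in D ∩ E, f ω ∂μ := by
    rw [hJeq]
    exact setIntegral_union hdisj MeasurableSet.of_discrete (Integrable.of_finite).integrableOn
      (Integrable.of_finite).integrableOn
  have hDc : D = (openConn x y)ᶜ := rfl
  have hmD : MeasurableSet (openConn x y : Set (BondConfig V)) := MeasurableSet.of_discrete
  have hIf : ∫ ω in D, f ω ∂μ = ∫ ω, f ω ∂μ - ∫ ω in openConn x y, f ω ∂μ := by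
    have e := integral_add_compl hmD (Integrable.of_finite : Integrable f μ)
    rw [hDc]
    linarith
  have hmDc : μ.real D = 1 - μ.real (openConn x y) := by
    rw [hDc, measureReal_compl hmD, probReal_univ]
  have hDnn : 0 ≤ μ.real D := measureReal_nonneg
  have hEnn : 0 ≤ μ.real (D ∩ E) := measureReal_nonneg
  have h1 : μ.real D * (μ.real J * ∫ ω, f ω ∂μ) ≤ μ.real D * ∫ ω in J, f ω ∂μ :=
    mul_le_mul_of_nonneg_left hH hDnn
  rw [hsplit, hJm] at h1
  rw [hIf] at h15
  rw [hmDc] at h1 h15 ⊢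
  nlinarith [h1, h15]

omit [Fintype V] in
/-- `{N ↮ s}` written with `sepEv`. [folklore] -/
theorem sepEv_singleton_eq (N : Set V) (s : V) :
    (sepEv N {s} : Set (Set (Sym2 V))) = {ω | ∀ n ∈ N, ¬ (openGraph ω).Reachable s n} := by
  ext ω
  simp only [sepEv, Set.mem_setOf_eq, Set.mem_singleton_iff, forall_eq]
  exact forall₂_congr fun n _ => not_congr SimpleGraph.reachable_comm

/-- **The set-observer covariance comparison as finite weighted sums** (the form used in `G − cut_X(ω)`): with
`Y = {s ↔ y}`, `E = {s ↮ y} ∩ {y ↔ N} ∩ {N ↮ s}`,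
`μ(E) · (E[F(C_s) 1_Y] − μ(Y) E[F(C_s)]) ≤ μ(s ↮ y) · (E[F(C_s) 1{s ↔ N}] − μ(s ↔ N) E[F(C_s)])`.
[cite: VandenbergHaggstromKahn2005, Thms 1.4–1.5 (p. 7)] [cite: KozmaNitzan2024, Question 9 (p. 36)] -/
theorem setObs_cov_ge_edge_sum (w : Sym2 V → unitInterval) (s y : V) (N : Set V) (hsy : s ≠ y)
    (F : Set (Sym2 V) → ℝ) (hF : Monotone F) :
    (∑ ω, weight (fun e => (w e : ℝ)) ω *
          ind ((openConn s y : Set (BondConfig V))ᶜ ∩ (connS N y ∩ sepEv N {s})) ω) *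
        ((∑ ω, weight (fun e => (w e : ℝ)) ω * (F (openEdgeCluster ω s) * ind (openConn s y) ω)) -
          (∑ ω, weight (fun e => (w e : ℝ)) ω * ind (openConn s y) ω) *
            ∑ ω, weight (fun e => (w e : ℝ)) ω * F (openEdgeCluster ω s)) ≤
      (∑ ω, weight (fun e => (w e : ℝ)) ω * ind (openConn s y : Set (BondConfig V))ᶜ ω) *
        ((∑ ω, weight (fun e => (w e : ℝ)) ω * (F (openEdgeCluster ω s) * ind (connS N s) ω)) -
          (∑ ω, weight (fun e => (w e : ℝ)) ω * ind (connS N s) ω) *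
            ∑ ω, weight (fun e => (w e : ℝ)) ω * F (openEdgeCluster ω s)) := by
  classical
  have key := setObs_cov_ge_edge w s y N hsy F hF
  have hE : {ω : BondConfig V | ¬ (openGraph ω).Reachable s y} ∩
      ({ω | ∀ n ∈ N, ¬ (openGraph ω).Reachable s n} ∩ {ω | ∃ n ∈ N, (openGraph ω).Reachable y n}) =
      (openConn s y : Set (BondConfig V))ᶜ ∩ (connS N y ∩ sepEv N {s}) := by
    rw [sepEv_singleton_eq, Set.inter_comm {ω | ∀ n ∈ N, ¬ (openGraph ω).Reachable s n}]
    rfl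
  have hO : {ω : BondConfig V | ∃ n ∈ N, (openGraph ω).Reachable s n} = connS N s := rfl
  have hD : {ω : BondConfig V | ¬ (openGraph ω).Reachable s y} = (openConn s y : Set (BondConfig V))ᶜ := rfl
  rw [hE, hO, hD, measureReal_eq_sum, measureReal_eq_sum, measureReal_eq_sum, measureReal_eq_sum,
    setIntegral_eq_sum, setIntegral_eq_sum, integral_prodBernoulli_eq_sum] at key
  exact key

end HullPort

end

end Summit.CriticalPhenomena.PercolationContinuityZ3.Theorems
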